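import Mathlib.NumberTheory.Height.NumberField
import Mathlib.NumberTheory.Height.MvPolynomial
import Mathlib.Data.Nat.Choose.Bounds
import Literature.NumberTheory.Transcendental.QuadraticRelationsLogarithmsMahlerWeil
import Literature.NumberTheory.Transcendental.RoySmallValueEstimatesAbsHeightProofs

/-!
# Lifting step for the approximation property — heights (stub `stub_lift`, part 2)

Route `DiophantineDichotomy`, crux `ApproximationProperty` (stmt-Schanuel-6117), line
`orbit-interpolation-determinant`, registered stub `stub_lift`.  The currency conversion from the
Weil height of a point `(1 : β)` of a number field to NAIVE heights of integer polynomials —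
the first two of three proved, reusable steps, and one piece of real bookkeeping:

* `logHeight₁_le_of_isRoot` — HEIGHT OF A ROOT (Cauchy's bound at every place): for a root
  `x ∈ E` of a non-zero `p ∈ E[X]` of degree `≤ n` over a number field `E`,
  `h_E(x) ≤ [E:ℚ] log(n+1) + h_E(p₀ : ⋯ : pₙ)` (`|x|_v ≤ (n+1) maxₖ |pₖ/p_e|_v` at the
  archimedean places, `≤ maxₖ |pₖ/p_e|_v` at the finite ones, and the product formula through
  the tree's local-to-global lemma `mulHeight_optionElim_le`);
* `exists_logHeight_aeval_le` — HEIGHTS OF POLYNOMIAL VALUES, uniformly in the number field: for a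
  finite family `Q` of polynomials over `ℚ` in `m` variables there is `C` with
  `h_K((Q_j(β))_j) ≤ C ([K:ℚ] + h_K(1 : β))` for every number field `K` and `β ∈ Kᵐ` (monomials
  in `β` are a sub-tuple of a Segre multiplication table, then Mathlib's height bound for linear
  maps and the base-change formula for the rational coefficient matrix);
* `accuracy_aux` — the real-variable bookkeeping of the accuracy `exp(-(log H·Δ + d·Y)/c)` in
  the assembly of the stub.

(The third step, from the Weil height to an integer polynomial, is in the part `…LiftAlgebraic`.)
No new definitions; every theorem is proved.  Sources: BombieriGubler2006 §1.5–1.6;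
Waldschmidt2000 Ch. 3; folklore.
-/

-- `Summit.Schanuel.Schanuel.…` is the mandated summit/sub-problem namespace (single-conjunct summit), hence:
set_option linter.dupNamespace false

namespace Summit.Schanuel.Schanuel.Cruxes.ApproximationProperty.OrbitInterpolationDeterminant

open Polynomial NumberField Height
open Literature.NumberTheory.Transcendental

noncomputable section

/-! ## Height of a root of a polynomial over a number field -/

/-- The local step of Cauchy's bound: if `x ^ e = -∑_{i<e} cᵢ xⁱ`, all `|cᵢ|_v ≤ M` with `M ≥ 1`,
and the absolute value `v` of a sum of `e` terms bounded by `B` is at most `C · B` (`C = e` at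
an archimedean place, `C = 1` at an ultrametric one), then `|x|_v ≤ C · M`. [folklore] -/
theorem absValue_le_of_pow_eq_neg_sum {E : Type*} [Field E] (v : AbsoluteValue E ℝ) {e : ℕ}
    (he : 1 ≤ e) (c : ℕ → E) {x : E} (hx : x ^ e = -∑ i ∈ Finset.range e, c i * x ^ i)
    {M C : ℝ} (hM : 1 ≤ M) (hC : 1 ≤ C) (hcM : ∀ i ∈ Finset.range e, v (c i) ≤ M)
    (hv : ∀ (f : ℕ → E) (B : ℝ), 0 ≤ B → (∀ i ∈ Finset.range e, v (f i) ≤ B) →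
      v (∑ i ∈ Finset.range e, f i) ≤ C * B) :
    v x ≤ C * M := by
  rcases le_or_gt (v x) 1 with h1 | h1
  · calc v x ≤ 1 := h1
      _ = 1 * 1 := (mul_one _).symm
      _ ≤ C * M := mul_le_mul hC hM zero_le_one (by linarith)
  · have hx0 : 0 < v x := one_pos.trans h1
    have hB : 0 ≤ M * v x ^ (e - 1) := by positivity
    have hterm : ∀ i ∈ Finset.range e, v (c i * x ^ i) ≤ M * v x ^ (e - 1) := by
      intro i hi
      rw [map_mul, map_pow]
      have hi' : i ≤ e - 1 := by
        have := Finset.mem_range.mp hi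
        omega
      exact mul_le_mul (hcM i hi) (pow_le_pow_right₀ h1.le hi') (by positivity) (by linarith)
    have h2 : v x ^ e ≤ C * (M * v x ^ (e - 1)) := by
      have h3 := hv (fun i => c i * x ^ i) _ hB hterm
      calc v x ^ e = v (x ^ e) := (map_pow v x e).symm
        _ = v (∑ i ∈ Finset.range e, c i * x ^ i) := by rw [hx, AbsoluteValue.map_neg]
        _ ≤ _ := h3
    have h3 : v x ^ e = v x * v x ^ (e - 1) := by
      rw [← pow_succ', Nat.sub_add_cancel he]
    rw [h3] at h2
    have hpos : 0 < v x ^ (e - 1) := pow_pos hx0 _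
    exact le_of_mul_le_mul_right (by linarith [h2]) hpos

/-- **Height of a root (multiplicative form).** For a number field `E`, a non-zero `p ∈ E[X]`
of degree `≤ n` and a root `x ∈ E` of `p`:
`H_E(x) ≤ (n+1)^{[E:ℚ]} · H_E(p₀ : p₁ : ⋯ : pₙ)` (Cauchy's bound `max(1, |x|_v) ≤ c_v maxₖ |pₖ/pₑ|_v`
with `c_v = n + 1` or `1`, and the product formula). [folklore] -/
theorem mulHeight₁_le_of_isRoot {E : Type*} [Field E] [NumberField E] {p : E[X]} (hp : p ≠ 0)
    {x : E} (hx : p.IsRoot x) {n : ℕ} (hn : p.natDegree ≤ n) :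
    mulHeight₁ x ≤
      ((n : ℝ) + 1) ^ Module.finrank ℚ E * mulHeight (fun k : Fin (n + 1) => p.coeff k) := by
  classical
  set a := p.leadingCoeff with ha
  have ha0 : a ≠ 0 := leadingCoeff_ne_zero.mpr hp
  set e := p.natDegree with he
  have he1 : 1 ≤ e := by
    by_contra h
    have h0 : p.natDegree = 0 := by omega
    have hpC := Polynomial.eq_C_of_natDegree_eq_zero h0
    rw [hpC, IsRoot, eval_C] at hx
    apply ha0
    rw [ha, Polynomial.leadingCoeff, h0]
    exact hx
  -- normalised coefficients `cᵢ = pᵢ / pₑ`, `cₑ = 1`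
  set c : ℕ → E := fun k => a⁻¹ * p.coeff k with hc
  have hce : c e = 1 := by
    simp only [hc, he]
    rw [Polynomial.coeff_natDegree, ← ha, inv_mul_cancel₀ ha0]
  have hxe : x ^ e = -∑ i ∈ Finset.range e, c i * x ^ i := by
    have h1 : ∑ i ∈ Finset.range (e + 1), p.coeff i * x ^ i = 0 := by
      rw [← Polynomial.eval_eq_sum_range]
      exact hx
    rw [Finset.sum_range_succ] at h1
    have h2 : p.coeff e = a := by rw [ha, Polynomial.coeff_natDegree]
    rw [h2] at h1
    have h4 : a * x ^ e = -∑ i ∈ Finset.range e, p.coeff i * x ^ i := by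
      linear_combination h1
    calc x ^ e = a⁻¹ * (a * x ^ e) := by rw [← mul_assoc, inv_mul_cancel₀ ha0, one_mul]
      _ = -∑ i ∈ Finset.range e, c i * x ^ i := by
          rw [h4, mul_neg, Finset.mul_sum]
          congr 1
          refine Finset.sum_congr rfl fun i _ => ?_
          simp only [hc, mul_assoc]
  set cF : Fin (n + 1) → E := fun k => c k with hcF
  have hcoeff : (fun k : Fin (n + 1) => p.coeff k) = a • cF := by
    funext k
    simp only [hcF, hc, Pi.smul_apply, smul_eq_mul, ← mul_assoc, mul_inv_cancel₀ ha0, one_mul]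
  rw [hcoeff, mulHeight_smul_eq_mulHeight _ ha0]
  -- the local bounds at all places
  set k₀ : Fin (n + 1) := ⟨e, Nat.lt_succ_of_le hn⟩ with hk₀
  have hcFk₀ : cF k₀ = 1 := by simp only [hcF, hk₀]; exact hce
  have hlocal : ∀ (v : AbsoluteValue E ℝ) (C : ℝ), 1 ≤ C →
      (∀ (f : ℕ → E) (B : ℝ), 0 ≤ B → (∀ i ∈ Finset.range e, v (f i) ≤ B) →
        v (∑ i ∈ Finset.range e, f i) ≤ C * B) →
      v x ≤ C * ⨆ o : Option (Fin (n + 1)), v (o.elim (1 : E) cF) := by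
    intro v C hC hv
    refine absValue_le_of_pow_eq_neg_sum v he1 c hxe (one_le_iSup_optionElim v cF) hC ?_ hv
    intro i hi
    have hi' : i < n + 1 := by
      have := Finset.mem_range.mp hi
      omega
    have := apply_le_iSup_optionElim v cF ⟨i, hi'⟩
    exact this
  have harch : ∀ (v : InfinitePlace E) (_s : Unit),
      v.val x ≤ ((n : ℝ) + 1) * ⨆ o : Option (Fin (n + 1)), v.val (o.elim (1 : E) cF) := by
    intro v _
    refine hlocal v.val _ (by linarith [n.cast_nonneg (α := ℝ)]) fun f B hB hfB => ?_
    calc v.val (∑ i ∈ Finset.range e, f i) ≤ ∑ i ∈ Finset.range e, v.val (f i) :=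
          v.val.sum_le _ _
      _ ≤ ∑ _i ∈ Finset.range e, B := Finset.sum_le_sum hfB
      _ = e * B := by rw [Finset.sum_const, Finset.card_range, nsmul_eq_mul]
      _ ≤ ((n : ℝ) + 1) * B := by
          apply mul_le_mul_of_nonneg_right _ hB
          have : (e : ℝ) ≤ n := by exact_mod_cast hn
          linarith
  have hfin : ∀ (w : FinitePlace E) (_s : Unit),
      w.val x ≤ ⨆ o : Option (Fin (n + 1)), w.val (o.elim (1 : E) cF) := by
    intro w _
    have hna : IsNonarchimedean (w.val : E → ℝ) := fun a b => FinitePlace.add_le w a b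
    have h := hlocal w.val 1 le_rfl fun f B hB hfB => ?_
    · rwa [one_mul] at h
    · rw [one_mul]
      have hne : (Finset.range e).Nonempty := Finset.nonempty_range_iff.mpr (by omega)
      exact (hna.apply_sum_le_sup hne).trans (Finset.sup'_le hne _ hfB)
  have key := mulHeight_optionElim_le cF (fun _ : Unit => x) (C := (n : ℝ) + 1)
    (by linarith [n.cast_nonneg (α := ℝ)]) harch hfin
  -- translate both sides
  have hlhs : mulHeight₁ x = mulHeight (fun o : Option Unit => o.elim (1 : E) (fun _ : Unit => x)) := by
    rw [mulHeight₁_eq_mulHeight]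
    have e1 : (fun o : Option Unit => o.elim (1 : E) (fun _ : Unit => x)) =
        ![x, 1] ∘ optionUnitEquivFinTwo := by
      funext o
      cases o <;> simp [optionUnitEquivFinTwo]
    rw [e1, mulHeight_comp_equiv]
  have hrhs : mulHeight (fun o : Option (Fin (n + 1)) => o.elim (1 : E) cF) ≤ mulHeight cF := by
    have e2 : (fun o : Option (Fin (n + 1)) => o.elim (1 : E) cF) =
        cF ∘ (fun o : Option (Fin (n + 1)) => o.elim k₀ id) := by
      funext o
      cases o with
      | none => simp [hcFk₀]
      | some k => simp
    rw [e2]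
    exact mulHeight_comp_le _ _
  rw [hlhs]
  refine key.trans ?_
  exact mul_le_mul_of_nonneg_left hrhs (by positivity)

/-- **Height of a root (logarithmic form).** `h_E(x) ≤ [E:ℚ] log(n+1) + h_E(p₀ : ⋯ : pₙ)` for a
root `x ∈ E` of a non-zero `p ∈ E[X]` of degree `≤ n`. [folklore] -/
theorem logHeight₁_le_of_isRoot {E : Type*} [Field E] [NumberField E] {p : E[X]} (hp : p ≠ 0)
    {x : E} (hx : p.IsRoot x) {n : ℕ} (hn : p.natDegree ≤ n) :
    logHeight₁ x ≤ Module.finrank ℚ E * Real.log ((n : ℝ) + 1) +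
      logHeight (fun k : Fin (n + 1) => p.coeff k) := by
  have h := mulHeight₁_le_of_isRoot hp hx hn
  have hn0 : (0 : ℝ) < (n : ℝ) + 1 := by positivity
  have hlog := Real.log_le_log (mulHeight₁_pos x) h
  rw [Real.log_mul (by positivity) (mulHeight_pos _).ne', Real.log_pow] at hlog
  rw [logHeight₁_eq_log_mulHeight₁, logHeight_eq_log_mulHeight]
  exact hlog

/-! ## Heights of values of polynomials with rational coefficients -/

/-- The monomials of degree `≤ N` in each variable are a sub-tuple of the Segre multiplication
table of `m · N` copies of `(βₖ, 1)`, whence `H((β^u)_u) ≤ H(1 : β)^{m N}`. [folklore] -/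
theorem mulHeight_monomials_le {K : Type*} [Field K] [NumberField K] {m : ℕ} (N : ℕ)
    (β : Fin m → K) :
    mulHeight (fun u : Fin m → Fin (N + 1) => ∏ k, β k ^ (u k : ℕ)) ≤
      mulHeight (Fin.cons (1 : K) β : Fin (m + 1) → K) ^ (m * N) := by
  classical
  set x : Fin m × Fin N → Fin 2 → K := fun a => ![β a.1, (1 : K)] with hx
  have hx0 : ∀ a, x a ≠ 0 := fun a h => by
    have := congrFun h 1
    simp [hx] at this
  have hT := mulHeight_fun_prod_eq (x := x) hx0
  set f : (Fin m → Fin (N + 1)) → (Fin m × Fin N → Fin 2) := fun u a =>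
    if (a.2 : ℕ) < (u a.1 : ℕ) then 0 else 1 with hf
  have hpow : ∀ (b : K) (c : ℕ), c ≤ N → (∏ l : Fin N, if (l : ℕ) < c then b else 1) = b ^ c := by
    intro b c hc
    rw [Fin.prod_univ_eq_prod_range (fun l => if l < c then b else 1) N, ← Finset.prod_filter,
      Finset.range_eq_Ico, Finset.Ico_filter_lt, min_eq_right hc, Finset.prod_const, Nat.card_Ico,
      Nat.sub_zero]
  have hcomp : (fun I : Fin m × Fin N → Fin 2 => ∏ a, x a (I a)) ∘ f =
      fun u : Fin m → Fin (N + 1) => ∏ k, β k ^ (u k : ℕ) := by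
    funext u
    simp only [Function.comp_apply]
    have h1 : ∀ a : Fin m × Fin N, x a (f u a) = if (a.2 : ℕ) < (u a.1 : ℕ) then β a.1 else 1 := by
      intro a
      simp only [hx, hf]
      split_ifs <;> simp
    rw [Finset.prod_congr rfl fun a _ => h1 a, Fintype.prod_prod_type]
    refine Finset.prod_congr rfl fun k _ => ?_
    exact hpow (β k) (u k) (Nat.lt_succ_iff.mp (u k).2)
  rw [← hcomp]
  refine (mulHeight_comp_le _ _).trans ?_
  rw [hT]
  have hle : ∀ a : Fin m × Fin N, mulHeight (x a) ≤ mulHeight (Fin.cons (1 : K) β : Fin (m + 1) → K) := by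
    intro a
    have e1 : x a = (Fin.cons (1 : K) β : Fin (m + 1) → K) ∘ ![a.1.succ, 0] := by
      funext i
      fin_cases i <;> simp [hx]
    rw [e1]
    exact mulHeight_comp_le _ _
  calc ∏ a, mulHeight (x a) ≤ ∏ _a : Fin m × Fin N, mulHeight (Fin.cons (1 : K) β : Fin (m + 1) → K) :=
        Finset.prod_le_prod (fun a _ => (mulHeight_pos _).le) fun a _ => hle a
    _ = _ := by rw [Finset.prod_const, Finset.card_univ, Fintype.card_prod, Fintype.card_fin,
        Fintype.card_fin]

/-- **Heights of polynomial values, uniformly in the number field.** For a finite family `Q` of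
polynomials in `m` variables with rational coefficients there is `C ≥ 0` such that for every
number field `K` and `β ∈ Kᵐ`, `h_K((Q_j(β))_j) ≤ C · ([K:ℚ] + h_K(1 : β))`. [folklore] -/
theorem exists_logHeight_aeval_le {m : ℕ} {κ : Type} [Fintype κ]
    (Q : κ → MvPolynomial (Fin m) ℚ) :
    ∃ C : ℝ, 0 ≤ C ∧ ∀ (K : Type) [Field K] [NumberField K] (β : Fin m → K),
      logHeight (fun j => MvPolynomial.aeval β (Q j)) ≤
        C * (Module.finrank ℚ K + logHeight (Fin.cons (1 : K) β : Fin (m + 1) → K)) := by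
  classical
  set N : ℕ := Finset.univ.sup fun j => (Q j).totalDegree with hN
  set toF : (Fin m → Fin (N + 1)) → (Fin m →₀ ℕ) := fun u =>
    Finsupp.equivFunOnFinite.symm (fun k => (u k : ℕ)) with htoF
  have htoF_apply : ∀ u k, toF u k = (u k : ℕ) := fun u k => by simp [htoF]
  have hinj : Function.Injective toF := by
    intro u u' h
    funext k
    apply Fin.ext
    rw [← htoF_apply u k, ← htoF_apply u' k, h]
  set A : κ × (Fin m → Fin (N + 1)) → ℚ := fun p => (Q p.1).coeff (toF p.2) with hA
  -- the constant
  set C : ℝ := max (Real.log (Nat.card (Fin m → Fin (N + 1))) + logHeight A) ((m : ℝ) * N) with hC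
  have hlogcard : 0 ≤ Real.log (Nat.card (Fin m → Fin (N + 1))) :=
    Real.log_natCast_nonneg _
  have hC0 : 0 ≤ C := le_max_of_le_left (add_nonneg hlogcard (logHeight_nonneg _))
  refine ⟨C, hC0, fun K _ _ β => ?_⟩
  -- evaluation as a linear map on the monomials
  have heval : (fun j => MvPolynomial.aeval β (Q j)) = fun j =>
      ∑ u : Fin m → Fin (N + 1), (algebraMap ℚ K (A (j, u))) * ∏ k, β k ^ (u k : ℕ) := by
    funext j
    rw [MvPolynomial.aeval_def, MvPolynomial.eval₂_eq']
    have hsub : (Q j).support ⊆ Finset.univ.image toF := by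
      intro d hd
      rw [Finset.mem_image]
      refine ⟨fun k => ⟨d k, Nat.lt_succ_of_le ?_⟩, Finset.mem_univ _, ?_⟩
      · calc d k ≤ (Q j).degreeOf k := MvPolynomial.le_degreeOf_of_mem_support k hd
          _ ≤ (Q j).totalDegree := MvPolynomial.degreeOf_le_totalDegree _ _
          _ ≤ N := Finset.le_sup (f := fun j => (Q j).totalDegree) (Finset.mem_univ j)
      · ext k
        rw [htoF_apply]
    rw [Finset.sum_subset hsub (fun d _ hd => by
      rw [MvPolynomial.notMem_support_iff.mp hd, map_zero, zero_mul])]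
    rw [Finset.sum_image fun u _ u' _ h => hinj h]
    refine Finset.sum_congr rfl fun u _ => ?_
    simp only [hA, htoF_apply]
  have hlin := logHeight_linearMap_apply_le (fun p : κ × (Fin m → Fin (N + 1)) => algebraMap ℚ K (A p))
    (fun u : Fin m → Fin (N + 1) => ∏ k, β k ^ (u k : ℕ))
  rw [← heval] at hlin
  -- the coefficient matrix: base change from `ℚ`
  have hAK : logHeight (fun p : κ × (Fin m → Fin (N + 1)) => algebraMap ℚ K (A p)) =
      Module.finrank ℚ K * logHeight A :=
    NumberField.logHeight_comp_algebraMap (K := ℚ) (L := K) A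
  -- the monomials
  have hmono : logHeight (fun u : Fin m → Fin (N + 1) => ∏ k, β k ^ (u k : ℕ)) ≤
      (m : ℝ) * N * logHeight (Fin.cons (1 : K) β : Fin (m + 1) → K) := by
    have h := Real.log_le_log (mulHeight_pos _) (mulHeight_monomials_le N β)
    rw [Real.log_pow] at h
    rw [logHeight_eq_log_mulHeight, logHeight_eq_log_mulHeight]
    exact_mod_cast h
  rw [hAK, totalWeight_eq_finrank] at hlin
  have hD : (0 : ℝ) ≤ Module.finrank ℚ K := Nat.cast_nonneg _
  have hh : 0 ≤ logHeight (Fin.cons (1 : K) β : Fin (m + 1) → K) := logHeight_nonneg _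
  have hC1 : Real.log (Nat.card (Fin m → Fin (N + 1))) + logHeight A ≤ C := le_max_left _ _
  have hC2 : (m : ℝ) * N ≤ C := le_max_right _ _
  calc logHeight (fun j => MvPolynomial.aeval β (Q j))
      ≤ Module.finrank ℚ K * Real.log (Nat.card (Fin m → Fin (N + 1))) +
          Module.finrank ℚ K * logHeight A +
          logHeight (fun u : Fin m → Fin (N + 1) => ∏ k, β k ^ (u k : ℕ)) := hlin
    _ ≤ Module.finrank ℚ K * Real.log (Nat.card (Fin m → Fin (N + 1))) +
          Module.finrank ℚ K * logHeight A +
          (m : ℝ) * N * logHeight (Fin.cons (1 : K) β : Fin (m + 1) → K) := by linarith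
    _ = Module.finrank ℚ K * (Real.log (Nat.card (Fin m → Fin (N + 1))) + logHeight A) +
          (m : ℝ) * N * logHeight (Fin.cons (1 : K) β : Fin (m + 1) → K) := by ring
    _ ≤ Module.finrank ℚ K * C + C * logHeight (Fin.cons (1 : K) β : Fin (m + 1) → K) := by
        gcongr
    _ = C * (Module.finrank ℚ K + logHeight (Fin.cons (1 : K) β : Fin (m + 1) → K)) := by ring

/-! ## Real-variable bookkeeping for the accuracy -/

/-- The accuracy arithmetic of the lifting step: from `uⁿ ≤ L₀ e^{-S/c₁}` with `n ≤ e`,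
`2 c₁ log L₀ ≤ S` and `2 c₁ e M ≤ c` to `u ≤ e^{-M S / c}`. -/
theorem accuracy_aux {u L₀ S c₁ c M : ℝ} {n e : ℕ} (hu : 0 ≤ u) (hn : 0 < n) (hne : n ≤ e)
    (hL₀ : 0 < L₀) (hc₁ : 0 < c₁) (hc : 0 < c) (hM : 0 ≤ M) (hS : 0 ≤ S)
    (hSL : 2 * c₁ * Real.log L₀ ≤ S) (hcM : 2 * c₁ * (e * M) ≤ c)
    (h : u ^ n ≤ L₀ * Real.exp (-(S / c₁))) : u ≤ Real.exp (-(M * S / c)) := by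
  have h2 : L₀ * Real.exp (-(S / c₁)) ≤ Real.exp (-(S / (2 * c₁))) := by
    have hlogL : Real.log L₀ ≤ S / (2 * c₁) := by
      rw [le_div_iff₀ (by positivity)]
      linarith
    have hhalf : S / c₁ = 2 * (S / (2 * c₁)) := by
      field_simp
    rw [← Real.exp_log hL₀, ← Real.exp_add, Real.exp_le_exp, hhalf]
    linarith
  have h3 : Real.exp (-(S / (2 * c₁))) ≤ Real.exp (-(M * S / c)) ^ n := by
    rw [← Real.exp_nat_mul, Real.exp_le_exp]
    have hne' : (n : ℝ) ≤ e := by exact_mod_cast hne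
    have h4 : (n : ℝ) * M ≤ e * M := mul_le_mul_of_nonneg_right hne' hM
    have key : (n : ℝ) * (M * S / c) ≤ S / (2 * c₁) := by
      rw [mul_div_assoc', div_le_div_iff₀ hc (by positivity)]
      calc (n : ℝ) * (M * S) * (2 * c₁) = (2 * c₁ * (n * M)) * S := by ring
        _ ≤ (2 * c₁ * (e * M)) * S := by
            apply mul_le_mul_of_nonneg_right _ hS
            exact mul_le_mul_of_nonneg_left h4 (by positivity)
        _ ≤ c * S := mul_le_mul_of_nonneg_right hcM hS
        _ = S * c := mul_comm _ _
    have h5 : (n : ℝ) * -(M * S / c) = -((n : ℝ) * (M * S / c)) := by ring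
    rw [h5]
    linarith
  have h4 : u ^ n ≤ Real.exp (-(M * S / c)) ^ n := h.trans (h2.trans h3)
  exact (pow_le_pow_iff_left₀ hu (Real.exp_pos _).le hn.ne').mp h4

/-! ## The registered sub-goal of this file -/

/-- REGISTERED SUB-GOAL `stub_lift_heights` of stub `stub_lift` (crux stmt-Schanuel-6117; this
helper file's deliverable, in the registered `∀`-chain shape): (1) the HEIGHT OF A ROOT of a
polynomial over a number field; (2) the HEIGHTS OF POLYNOMIAL VALUES, uniformly in the number
field. -/
theorem stub_lift_heights :
    (∀ (E : Type) [Field E] [NumberField E] (p : Polynomial E) (x : E) (n : ℕ), p ≠ 0 →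
      p.IsRoot x → p.natDegree ≤ n →
      Height.logHeight₁ x ≤ Module.finrank ℚ E * Real.log ((n : ℝ) + 1) +
        Height.logHeight (fun k : Fin (n + 1) => p.coeff k)) ∧
    (∀ (m : ℕ) (κ : Type) [Fintype κ] (Q : κ → MvPolynomial (Fin m) ℚ),
      ∃ C : ℝ, 0 ≤ C ∧ ∀ (K : Type) [Field K] [NumberField K] (β : Fin m → K),
        Height.logHeight (fun j => MvPolynomial.aeval β (Q j)) ≤
          C * (Module.finrank ℚ K + Height.logHeight (Fin.cons (1 : K) β : Fin (m + 1) → K))) :=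
  ⟨fun _ _ _ _ _ _ hp hx hn => logHeight₁_le_of_isRoot hp hx hn,
    fun _ _ _ Q => exists_logHeight_aeval_le Q⟩

end

end Summit.Schanuel.Schanuel.Cruxes.ApproximationProperty.OrbitInterpolationDeterminant
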